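import Literature.Analysis.FluidPDE.HomSobolevWeakLimits
import Literature.Analysis.FluidPDE.CriticalSpacesProofs
import Literature.Analysis.FluidPDE.RusinSverakMinimalData
import Literature.Analysis.FunctionSpaces.FourierSobolevNormEmbeddingProofs
import HarnessLib

/-!
# Represented `Ḣ^{1/2}(ℝ³)` data are `L³` data: the represented field, its `L³` bound, and weak
`L³` convergence along weak `Ḣ^{1/2}` limits

Analysis/FluidPDE support file, definitions-free. It serves the named facts transcribing
Rusin–Šverák, *Minimal initial data for potential Navier–Stokes singularities*, J. Funct. Anal.
260 (2011) 879–891 = arXiv:0911.0500 (`rusin_sverak_weak_limit_blowup`,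
`RusinSverakCompactnessProofs.lean`; its two PDE inputs `rusin_sverak_singular_point_of_blowup`
and `rusin_sverak_weak_limit_of_singular_points` = Cor. 4.2, `RusinSverakWeakStability.lean`),
in which an initial datum is an `L³` field `u₀ : ℝ³ → ℝ³` *represented* by a Fourier-side class
`g ∈ Ḣ^{1/2}(ℝ³; ℂ³) = L²(‖ξ‖ dξ; ℂ³)` (`HomSobolev.Represents`, `MildSolutions.lean`:
`∫ 𝓕φ • u₀ = ∫ φ • g` for every Schwartz `φ`), a sequence of data is "bounded in `Ḣ^{1/2}`"
through `‖g_k‖ ≤ R`, and "converges weakly in `Ḣ^{1/2}`" through `⟪g_k, w⟫ → ⟪g, w⟫`.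

The printed proofs that these facts cite, and their detailed versions in the `L³` setting —
Jia–Šverák, *Minimal `L³`-initial data for potential Navier–Stokes singularities*, SIAM J. Math.
Anal. 45 (2013) = arXiv:1201.1592 (arXiv numbering: Lemma 7, §4: a finite maximal time forces
a singular point; Thm. 1, §5, and its proof: weak limits of normalised blow-up data blow up) and Lemarié-Rieusset, *The Navier–Stokes problem in the 21st century* (2016), Thm. 15.1 and
Thm. 15.11 — run on two pieces of bookkeeping about the *data* which the tree did not yet have
in the represented setting, and which this file **proves**:

* **the `L³` size of the data is controlled by the `Ḣ^{1/2}` size** (Jia–Šverák 2013, proof of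
  Thm. 1: all constants depend on `sup_k ‖u₀^k‖_{L³}`; Lemarié-Rieusset 2016, Thm. 15.11:
  `ℬ_{3,M}`): `HomSobolev.Represents.eLpNorm_three_le` — if `g ∈ Ḣ^{1/2}(ℝ³)` represents `f`,
  then `‖f‖_{L³} ≤ C ‖g‖_{Ḣ^{1/2}}` with the constant of the tree's (discharged) Sobolev
  inequality `eLpNorm_three_le_eHomSobolevSeminorm_half` (Bahouri–Chemin–Danchin 2011,
  Thm. 1.38, stated there for `L²` functions only); in particular every represented field is
  automatically in `L³` (`HomSobolev.Represents.memLp_three`), and a sequence of represented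
  data bounded in `Ḣ^{1/2}` is bounded in `L³`
  (`exists_eLpNorm_three_le_of_represents_of_norm_le`, the hypothesis format of
  `rusin_sverak_weak_limit_of_singular_points`);
* **weak `Ḣ^{1/2}` limits of represented data are weak `L³` limits** (Jia–Šverák 2013, proof
  of Thm. 1: "`u₀^k ⇀ u₀` in `L³(ℝ³)`"; Lemarié-Rieusset 2016, Thm. 15.11: "`ŵ_{n_k} ⇀* w_∞`"):
  `HomSobolev.Represents.tendsto_inner_integral_smul_of_memLp` — if `g_n ⇀ g` weakly in
  `Ḣ^{1/2}` with `‖g_n‖` bounded, `g_n` represents `f_n` and `g` represents `f`, then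
  `⟪c, ∫ ψ • f_n⟫ → ⟪c, ∫ ψ • f⟫` for every `ψ ∈ L^{3/2}(ℝ³)` and `c ∈ F` (density of test
  functions in `L^{3/2}`, Mathlib `MemLp.exist_eLpNorm_sub_le`, the uniform `L³` bound, and the
  Schwartz case `HomSobolev.Represents.tendsto_inner_integral_smul` of `HomSobolevWeakLimits.lean`).

On the way: the represented field is locally integrable and determined a.e. by its class
(`HomSobolev.Represents.locallyIntegrable`, `.integral_smul_eq`, `.ae_eq`; Bahouri–Chemin–Danchin
2011, Prop. 1.34: `Ḣ^s ↪ 𝓢'` for `s < d/2`), `Represents` is additive (`.add`, `.neg`, `.sub`,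
`represents_zero`; with `.smul` of `KatoViscosityScaling.lean` it is `ℂ`-linear), and the
constant-tracking form `HomSobolev.exists_represents_eLpNorm_three_le` of
`HomSobolev.exists_represents_memLp_three` (`HomSobolevWeakLimits.lean`, whose truncation
argument is repeated here keeping track of `‖f_n‖_{L³} ≤ C ‖1_{‖ξ‖ ≥ 1/(n+1)} g‖ ≤ C ‖g‖`).

Nothing here is specific to Navier–Stokes; the last section merely specialises to the real
fields `complexify ∘ u₀` of the NS facts.

## Mathlib / tree search

Mathlib: `ae_eq_of_integral_contDiff_smul_eq`, `MemLp.exist_eLpNorm_sub_le`,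
`HasCompactSupport.toSchwartzMap`, `eLpNorm_smul_le_mul_eLpNorm`, `eLpNorm_indicator_le`,
`eLpNorm_congr_norm_ae`, `Metric.tendsto_atTop`, `dist_triangle4`. Tree (reused, not restated):
`HomSobolev.Represents` (`MildSolutions.lean`), `HomSobolev.Represents.unique`, `.smul`,
`.locallyIntegrable_toLp` (`KatoViscosityScaling.lean`), `HomSobolev.exists_represents_memLp_three`,
`.tendsto_inner_integral_smul`, `integrable_smul_of_memLp_half`, `enorm_integral_smul_le`
(`HomSobolevWeakLimits.lean`), `eLpNorm_three_le_eHomSobolevSeminorm_half_holds`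
(`FourierSobolevNormEmbeddingProofs.lean`), `memLp_complexify_comp_iff` (`CriticalSpacesProofs.lean`),
`norm_le_of_tendsto_inner_of_norm_le` (`RusinSverakMinimalData.lean`).

## References

* W. Rusin, V. Šverák, J. Funct. Anal. 260 (2011) 879–891 = arXiv:0911.0500, Cor. 4.2 and
  proof of Cor. 4.3 (p. 8).
* H. Jia, V. Šverák, SIAM J. Math. Anal. 45 (2013) 1448–1459 = arXiv:1201.1592 (arXiv
  numbering): Lemma 7 (§4) and Thm. 1 with its proof (§5).
* P. G. Lemarié-Rieusset, *The Navier–Stokes problem in the 21st century* (2016), Thm. 15.1,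
  Thm. 15.11.
* H. Bahouri, J.-Y. Chemin, R. Danchin, *Fourier Analysis and Nonlinear PDE* (2011), Prop. 1.34,
  Prop. 1.36, Thm. 1.38.
-/

noncomputable section

open MeasureTheory TopologicalSpace Filter Topology Set Function FourierTransform
open scoped ENNReal NNReal InnerProductSpace SchwartzMap

namespace Literature.Analysis.FluidPDE

section HomSobolev
open Literature.Analysis.FunctionSpaces (HomSobolev)
open Literature.Analysis.FunctionSpaces.HomSobolev

/-! ## The represented field is determined a.e.; linearity of `Represents` -/

section General

variable {E F : Type*} [NormedAddCommGroup E] [InnerProductSpace ℝ E] [FiniteDimensional ℝ E]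
  [MeasurableSpace E] [BorelSpace E] [NormedAddCommGroup F] [InnerProductSpace ℂ F]
  [CompleteSpace F]

omit [CompleteSpace F] in
/-- **A represented field is locally integrable.** If `g ∈ Ḣ^s` represents `f`
(`HomSobolev.Represents`), then `f ∈ L¹_loc`: `Represents` demands `∫ 𝓕φ • f` to converge for
every Schwartz `φ`, in particular for `φ = 𝓕⁻¹ b` with `b` a smooth bump `≡ 1` on a given ball
(twin of `Represents.locallyIntegrable_toLp` on the physical side; Bahouri–Chemin–Danchin 2011,
Prop. 1.34: `Ḣ^s ⊂ 𝓢'`). Deliberate dot-notation extension of the tree's `HomSobolev.Represents`.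
[folklore] -/
theorem _root_.Literature.Analysis.FunctionSpaces.HomSobolev.Represents.locallyIntegrable {s : ℝ}
    {g : HomSobolev E F s} {f : E → F} (h : g.Represents f) : LocallyIntegrable f volume := by
  intro x
  let b : ContDiffBump x := ⟨1, 2, one_pos, one_lt_two⟩
  have hb1 : HasCompactSupport (Complex.ofReal ∘ (b : E → ℝ)) :=
    b.hasCompactSupport.comp_left Complex.ofReal_zero
  have hb2 : ContDiff ℝ ((⊤ : ℕ∞) : WithTop ℕ∞) (Complex.ofReal ∘ (b : E → ℝ)) :=
    Complex.ofRealCLM.contDiff.comp b.contDiff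
  set ψ : 𝓢(E, ℂ) := hb1.toSchwartzMap hb2 with hψ_def
  have hint : Integrable (fun y => ψ y • f y) volume := by
    have := h.1 (𝓕⁻ ψ)
    rwa [fourier_fourierInv_eq] at this
  refine ⟨Metric.closedBall x 1, Metric.closedBall_mem_nhds x one_pos, ?_⟩
  refine (hint.integrableOn (s := Metric.closedBall x 1)).congr_fun (fun y hy => ?_)
    measurableSet_closedBall
  change ((Complex.ofReal ∘ (b : E → ℝ)) y) • _ = _
  simp [b.one_of_mem_closedBall hy]

omit [CompleteSpace F] in
/-- **Two fields represented by the same class have the same pairings with Schwartz functions**: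
`∫ ψ • f = ∫ ψ • f'` for all `ψ ∈ 𝓢` (write `ψ = 𝓕(𝓕⁻¹ψ)` and use the defining identity
`∫ 𝓕φ • f = ∫ φ • g`). [folklore] -/
theorem _root_.Literature.Analysis.FunctionSpaces.HomSobolev.Represents.integral_smul_eq {s : ℝ}
    {g : HomSobolev E F s} {f f' : E → F} (h : g.Represents f) (h' : g.Represents f')
    (ψ : 𝓢(E, ℂ)) : ∫ x, ψ x • f x = ∫ x, ψ x • f' x := by
  have h1 := h.2.2 (𝓕⁻ ψ)
  have h2 := h'.2.2 (𝓕⁻ ψ)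
  rw [fourier_fourierInv_eq] at h1 h2
  rw [h1, h2]

/-- **The represented field is determined a.e. by its class** (injectivity of `Ḣ^s ↪ 𝓢'` read
on the physical side; Bahouri–Chemin–Danchin 2011, Prop. 1.34): if `g` represents both `f` and
`f'`, then `f = f'` Lebesgue-a.e., since both are locally integrable with the same pairings
against real test functions (Mathlib `ae_eq_of_integral_contDiff_smul_eq`). Companion of
`Represents.unique` (uniqueness of the class given the field). [folklore] -/
theorem _root_.Literature.Analysis.FunctionSpaces.HomSobolev.Represents.ae_eq {s : ℝ}
    {g : HomSobolev E F s} {f f' : E → F} (h : g.Represents f) (h' : g.Represents f') :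
    f =ᵐ[volume] f' := by
  refine ae_eq_of_integral_contDiff_smul_eq h.locallyIntegrable h'.locallyIntegrable
    fun θ hθ hsupp => ?_
  have h1 : HasCompactSupport (Complex.ofReal ∘ θ) := hsupp.comp_left Complex.ofReal_zero
  have h2 : ContDiff ℝ ((⊤ : ℕ∞) : WithTop ℕ∞) (Complex.ofReal ∘ θ) :=
    Complex.ofRealCLM.contDiff.comp hθ
  have h3 := h.integral_smul_eq h' (h1.toSchwartzMap h2)
  have h4 : ∀ (G : E → F) (ξ : E), (h1.toSchwartzMap h2) ξ • G ξ = θ ξ • G ξ := fun G ξ => by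
    change ((Complex.ofReal ∘ θ) ξ) • G ξ = θ ξ • G ξ
    exact Complex.coe_smul _ _
  simpa only [h4] using h3

omit [CompleteSpace F] in
/-- **Additivity of `Represents`**: if `g` represents `f` and `g'` represents `f'`, then `g + g'`
represents `f + f'` (both pairings are additive; the stored class of `g + g'` is `volume`-a.e.
the sum of those of `g`, `g'`). With `Represents.smul` this makes the represented data a
`ℂ`-linear subspace (Bahouri–Chemin–Danchin 2011, Def. 1.31: `Ḣ^s` is a vector space of
tempered distributions). [folklore] -/
theorem _root_.Literature.Analysis.FunctionSpaces.HomSobolev.Represents.add [Nontrivial E] {s : ℝ}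
    {g g' : HomSobolev E F s} {f f' : E → F} (h : g.Represents f) (h' : g'.Represents f') :
    (g + g').Represents (f + f') := by
  have hae : (fun ξ => ((toLp s (g + g') : Lp F 2 (FunctionSpaces.homSobolevMeasure E s)) : E → F) ξ)
      =ᵐ[volume] fun ξ => ((toLp s g : Lp F 2 (FunctionSpaces.homSobolevMeasure E s)) : E → F) ξ +
        ((toLp s g' : Lp F 2 (FunctionSpaces.homSobolevMeasure E s)) : E → F) ξ := by
    have h1 : ((toLp s (g + g') : Lp F 2 (FunctionSpaces.homSobolevMeasure E s)) : E → F)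
        =ᵐ[FunctionSpaces.homSobolevMeasure E s]
        ((toLp s g : Lp F 2 (FunctionSpaces.homSobolevMeasure E s)) : E → F) +
          ((toLp s g' : Lp F 2 (FunctionSpaces.homSobolevMeasure E s)) : E → F) := by
      rw [map_add]
      exact Lp.coeFn_add _ _
    exact (volume_absolutelyContinuous_homSobolevMeasure s).ae_eq h1
  have hae' : ∀ φ : 𝓢(E, ℂ), (fun ξ => φ ξ • ((toLp s (g + g') :
      Lp F 2 (FunctionSpaces.homSobolevMeasure E s)) : E → F) ξ) =ᵐ[volume]
      fun ξ => φ ξ • ((toLp s g : Lp F 2 (FunctionSpaces.homSobolevMeasure E s)) : E → F) ξ +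
        φ ξ • ((toLp s g' : Lp F 2 (FunctionSpaces.homSobolevMeasure E s)) : E → F) ξ := fun φ => by
    filter_upwards [hae] with ξ hξ
    rw [hξ, smul_add]
  refine ⟨fun φ => ?_, fun φ => ?_, fun φ => ?_⟩
  · have hi := (h.1 φ).add (h'.1 φ)
    refine hi.congr (Eventually.of_forall fun x => ?_)
    simp only [Pi.add_apply, smul_add]
  · exact ((h.2.1 φ).add (h'.2.1 φ)).congr (hae' φ).symm
  · calc ∫ x, (𝓕 φ) x • (f + f') x = ∫ x, ((𝓕 φ) x • f x + (𝓕 φ) x • f' x) := by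
          refine integral_congr_ae (Eventually.of_forall fun x => ?_)
          simp only [Pi.add_apply, smul_add]
      _ = (∫ x, (𝓕 φ) x • f x) + ∫ x, (𝓕 φ) x • f' x := integral_add (h.1 φ) (h'.1 φ)
      _ = (∫ ξ, φ ξ • ((toLp s g : Lp F 2 (FunctionSpaces.homSobolevMeasure E s)) : E → F) ξ) +
            ∫ ξ, φ ξ • ((toLp s g' : Lp F 2 (FunctionSpaces.homSobolevMeasure E s)) : E → F) ξ := by
          rw [h.2.2 φ, h'.2.2 φ]
      _ = ∫ ξ, (φ ξ • ((toLp s g : Lp F 2 (FunctionSpaces.homSobolevMeasure E s)) : E → F) ξ +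
            φ ξ • ((toLp s g' : Lp F 2 (FunctionSpaces.homSobolevMeasure E s)) : E → F) ξ) :=
          (integral_add (h.2.1 φ) (h'.2.1 φ)).symm
      _ = ∫ ξ, φ ξ • ((toLp s (g + g') : Lp F 2 (FunctionSpaces.homSobolevMeasure E s)) : E → F) ξ :=
          integral_congr_ae (hae' φ).symm

omit [CompleteSpace F] in
/-- The zero class represents the zero field. [folklore] -/
theorem _root_.Literature.Analysis.FunctionSpaces.HomSobolev.represents_zero [Nontrivial E] {s : ℝ} :
    (0 : HomSobolev E F s).Represents (0 : E → F) := by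
  have hae : (fun ξ => ((toLp s (0 : HomSobolev E F s) : Lp F 2 (FunctionSpaces.homSobolevMeasure E s)) : E → F) ξ)
      =ᵐ[volume] fun _ => (0 : F) := by
    have h1 : ((toLp s (0 : HomSobolev E F s) : Lp F 2 (FunctionSpaces.homSobolevMeasure E s)) : E → F)
        =ᵐ[FunctionSpaces.homSobolevMeasure E s] 0 := by
      rw [map_zero]
      exact Lp.coeFn_zero _ _ _
    exact (volume_absolutelyContinuous_homSobolevMeasure s).ae_eq h1
  have hae' : ∀ φ : 𝓢(E, ℂ), (fun ξ => φ ξ • ((toLp s (0 : HomSobolev E F s) :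
      Lp F 2 (FunctionSpaces.homSobolevMeasure E s)) : E → F) ξ) =ᵐ[volume] fun _ => (0 : F) := fun φ => by
    filter_upwards [hae] with ξ hξ
    rw [hξ, smul_zero]
  refine ⟨fun φ => ?_, fun φ => ?_, fun φ => ?_⟩
  · simp only [Pi.zero_apply, smul_zero]
    exact integrable_zero _ _ _
  · exact (integrable_zero _ _ _).congr (hae' φ).symm
  · rw [integral_congr_ae (hae' φ)]
    simp

omit [CompleteSpace F] in
/-- `-g` represents `-f` when `g` represents `f` (`Represents.smul` with `c = -1`). [folklore] -/
theorem _root_.Literature.Analysis.FunctionSpaces.HomSobolev.Represents.neg [Nontrivial E] {s : ℝ}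
    {g : HomSobolev E F s} {f : E → F} (h : g.Represents f) : (-g).Represents (-f) := by
  have h1 := h.smul (-1 : ℂ)
  rwa [neg_one_smul, neg_one_smul] at h1

omit [CompleteSpace F] in
/-- `g - g'` represents `f - f'` when `g` represents `f` and `g'` represents `f'`. [folklore] -/
theorem _root_.Literature.Analysis.FunctionSpaces.HomSobolev.Represents.sub [Nontrivial E] {s : ℝ}
    {g g' : HomSobolev E F s} {f f' : E → F} (h : g.Represents f) (h' : g'.Represents f') :
    (g - g').Represents (f - f') := by
  rw [sub_eq_add_neg, sub_eq_add_neg]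
  exact h.add h'.neg

end General

/-! ## The `L³` norm of a represented field is controlled by the `Ḣ^{1/2}` norm -/

section SobolevRepr

universe u

variable {F : Type u} [NormedAddCommGroup F] [InnerProductSpace ℂ F] [CompleteSpace F]

/-- **Every class `g ∈ Ḣ^{1/2}(ℝ³)` is represented by an `L³` function of norm `≤ C ‖g‖`**,
where `C` is any constant of the Sobolev inequality `‖f‖_{L³} ≤ C ‖f‖_{Ḣ^{1/2}}` for `L²`
functions (Bahouri–Chemin–Danchin 2011, Thm. 1.38, `d = 3`, `s = 1/2`, `p = 3`; the tree's fact
`eLpNorm_three_le_eHomSobolevSeminorm_half`). Constant-tracking form of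
`HomSobolev.exists_represents_memLp_three` (`HomSobolevWeakLimits.lean`), same proof: the
truncations `gₙ = 1_{‖ξ‖ ≥ 1/(n+1)} g ∈ L² ∩ L²(‖ξ‖ dξ)` converge to `g` in `L²(‖ξ‖ dξ)`,
`fₙ = 𝓕⁻¹ gₙ ∈ L²` satisfy `‖fₙ‖_{L³} ≤ C ‖gₙ‖ ≤ C ‖g‖` and `‖fₙ - fₘ‖_{L³} ≤ C ‖gₙ - gₘ‖`, so
they converge in `L³` to some `f` with `‖f‖_{L³} ≤ C ‖g‖`, which represents `g` (Parseval for
`fₙ ∈ L²` and continuity of both pairings).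
[cite: BahouriCheminDanchin2011, Thm. 1.38 (d = 3, s = 1/2) with Prop. 1.34] -/
theorem _root_.Literature.Analysis.FunctionSpaces.HomSobolev.exists_represents_eLpNorm_three_le {C : ℝ≥0}
    (hC : ∀ f : EuclideanSpace ℝ (Fin 3) → F, MemLp f 2 volume →
      eLpNorm f 3 volume ≤ C * Function.eHomSobolevSeminorm (1 / 2 : ℝ) f)
    (g : HomSobolev (EuclideanSpace ℝ (Fin 3)) F (1 / 2 : ℝ)) :
    ∃ f : EuclideanSpace ℝ (Fin 3) → F, MemLp f 3 volume ∧ g.Represents f ∧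
      eLpNorm f 3 volume ≤ C * ‖g‖ₑ := by
  haveI : Fact ((1 : ℝ≥0∞) ≤ 3) := ⟨by norm_num⟩
  -- the Hölder pair `(3/2, 3)`
  have hHT : ENNReal.HolderTriple (3 / 2) 3 1 := by
    refine ⟨?_⟩
    have h1 : (3 / 2 : ℝ≥0∞)⁻¹ = 2 * 3⁻¹ := by
      rw [div_eq_mul_inv, ENNReal.mul_inv (Or.inl (by norm_num)) (Or.inl (by norm_num)), inv_inv,
        mul_comm]
    rw [h1, inv_one]
    calc (2 : ℝ≥0∞) * 3⁻¹ + 3⁻¹ = (2 + 1) * 3⁻¹ := by rw [add_mul, one_mul]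
      _ = 3 * 3⁻¹ := by norm_num
      _ = 1 := ENNReal.mul_inv_cancel (by norm_num) (by norm_num)
  set μ := FunctionSpaces.homSobolevMeasure (EuclideanSpace ℝ (Fin 3)) (1 / 2 : ℝ) with hμ
  have hμ' : μ = volume.withDensity fun ξ => ‖ξ‖ₑ := HomSobolevSymmetry.homSobolevMeasure_half_eq
  have hac : (volume : Measure (EuclideanSpace ℝ (Fin 3))) ≪ μ :=
    HomSobolevSymmetry.volume_absolutelyContinuous_homSobolevMeasure_half
  have hac' : μ ≪ (volume : Measure (EuclideanSpace ℝ (Fin 3))) :=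
    HomSobolevSymmetry.homSobolevMeasure_half_absolutelyContinuous_volume
  have hwd : ∀ h : EuclideanSpace ℝ (Fin 3) → ℝ≥0∞, ∫⁻ ξ, h ξ ∂μ = ∫⁻ ξ, ‖ξ‖ₑ * h ξ := fun h => by
    rw [hμ', lintegral_withDensity_eq_lintegral_mul_non_measurable₀ _ (by fun_prop)
      (Eventually.of_forall fun ξ => enorm_lt_top)]
    rfl
  have h0 : ∀ᵐ ξ ∂(volume : Measure (EuclideanSpace ℝ (Fin 3))), ξ ≠ 0 := by
    rw [ae_iff]; simp [measure_singleton]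
  -- the Fourier-side representative and its truncations away from the origin
  set G : EuclideanSpace ℝ (Fin 3) → F :=
    ((toLp (1 / 2 : ℝ) g : Lp F 2 μ) : EuclideanSpace ℝ (Fin 3) → F) with hG_def
  have hG : MemLp G 2 μ := Lp.memLp _
  set A : ℕ → Set (EuclideanSpace ℝ (Fin 3)) :=
    fun n => (Metric.ball (0 : EuclideanSpace ℝ (Fin 3)) (((n : ℝ) + 1)⁻¹))ᶜ with hA_def
  have hAm : ∀ n, MeasurableSet (A n) := fun n => measurableSet_ball.compl
  set Gn : ℕ → EuclideanSpace ℝ (Fin 3) → F := fun n => (A n).indicator G with hGn_def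
  have ha : ∀ n, MemLp (Gn n) 2 μ := fun n => hG.indicator (hAm n)
  -- the truncations are in `L²(volume)`
  have hb : ∀ n, MemLp (Gn n) 2 (volume : Measure (EuclideanSpace ℝ (Fin 3))) := fun n => by
    refine ⟨(hG.1.mono_ac hac).indicator (hAm n), ?_⟩
    rw [eLpNorm_lt_top_iff_lintegral_rpow_enorm_lt_top two_ne_zero ENNReal.ofNat_ne_top]
    simp only [ENNReal.toReal_ofNat, ENNReal.rpow_ofNat]
    have hfin : ∫⁻ ξ, ‖Gn n ξ‖ₑ ^ 2 ∂μ < ∞ := by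
      have := lintegral_rpow_enorm_lt_top_of_eLpNorm_lt_top two_ne_zero ENNReal.ofNat_ne_top
        (ha n).eLpNorm_lt_top
      simpa only [ENNReal.toReal_ofNat, ENNReal.rpow_ofNat] using this
    have hle : ∀ ξ, ‖Gn n ξ‖ₑ ^ 2 ≤ ENNReal.ofReal ((n : ℝ) + 1) * (‖ξ‖ₑ * ‖Gn n ξ‖ₑ ^ 2) :=
      fun ξ => by
      by_cases hξ : ξ ∈ A n
      · have h1 : (1 : ℝ≥0∞) ≤ ENNReal.ofReal ((n : ℝ) + 1) * ‖ξ‖ₑ := by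
          rw [← ofReal_norm, ← ENNReal.ofReal_mul (by positivity), ← ENNReal.ofReal_one]
          refine ENNReal.ofReal_le_ofReal ?_
          have hξ' : ((n : ℝ) + 1)⁻¹ ≤ ‖ξ‖ := by simpa [hA_def] using hξ
          calc (1 : ℝ) = ((n : ℝ) + 1) * ((n : ℝ) + 1)⁻¹ := by field_simp
            _ ≤ ((n : ℝ) + 1) * ‖ξ‖ := by gcongr
        calc ‖Gn n ξ‖ₑ ^ 2 = 1 * ‖Gn n ξ‖ₑ ^ 2 := (one_mul _).symm
          _ ≤ (ENNReal.ofReal ((n : ℝ) + 1) * ‖ξ‖ₑ) * ‖Gn n ξ‖ₑ ^ 2 := by gcongr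
          _ = _ := by ring
      · simp [hGn_def, Set.indicator_of_notMem hξ]
    calc ∫⁻ ξ, ‖Gn n ξ‖ₑ ^ 2 ≤ ∫⁻ ξ, ENNReal.ofReal ((n : ℝ) + 1) * (‖ξ‖ₑ * ‖Gn n ξ‖ₑ ^ 2) :=
          lintegral_mono hle
      _ = ENNReal.ofReal ((n : ℝ) + 1) * ∫⁻ ξ, ‖Gn n ξ‖ₑ ^ 2 ∂μ := by
          rw [lintegral_const_mul' _ _ ENNReal.ofReal_ne_top, hwd]
      _ < ∞ := ENNReal.mul_lt_top ENNReal.ofReal_lt_top hfin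
  -- the physical-side approximants `fₙ = 𝓕⁻¹ gₙ ∈ L²`
  set H : ℕ → Lp F 2 (volume : Measure (EuclideanSpace ℝ (Fin 3))) := fun n => (hb n).toLp (Gn n)
    with hH_def
  have hHae : ∀ n, (H n : EuclideanSpace ℝ (Fin 3) → F) =ᵐ[volume] Gn n := fun n => (hb n).coeFn_toLp
  set Φ : ℕ → Lp F 2 (volume : Measure (EuclideanSpace ℝ (Fin 3))) := fun n => 𝓕⁻ (H n) with hΦ_def
  have hΦ : ∀ n, (𝓕 (Φ n) : Lp F 2 (volume : Measure (EuclideanSpace ℝ (Fin 3)))) = H n := fun n =>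
    fourier_fourierInv_eq (H n)
  have hΦsub : ∀ n m, (𝓕 (Φ n - Φ m) : Lp F 2 (volume : Measure (EuclideanSpace ℝ (Fin 3)))) =
      H n - H m := fun n m => by
    rw [← hΦ n, ← hΦ m]
    exact (Lp.fourierTransformₗᵢ (EuclideanSpace ℝ (Fin 3)) F).map_sub (Φ n) (Φ m)
  -- `Ḣ^{1/2}` seminorms of the approximants and of their differences
  have hsemi : ∀ n m, Function.eHomSobolevSeminorm (1 / 2 : ℝ)
      ((Φ n : EuclideanSpace ℝ (Fin 3) → F) - (Φ m : EuclideanSpace ℝ (Fin 3) → F)) =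
        eLpNorm (Gn n - Gn m) 2 μ := fun n m => by
    rw [Function.eHomSobolevSeminorm_congr_ae (Lp.coeFn_sub (Φ n) (Φ m)).symm]
    refine eHomSobolevSeminorm_half_eq_eLpNorm (Φ n - Φ m) ?_
    rw [hΦsub]
    filter_upwards [Lp.coeFn_sub (H n) (H m), hHae n, hHae m] with x h1 h2 h3
    rw [h1, Pi.sub_apply, h2, h3, Pi.sub_apply]
  have hsemi1 : ∀ n, Function.eHomSobolevSeminorm (1 / 2 : ℝ) (Φ n : EuclideanSpace ℝ (Fin 3) → F) =
      eLpNorm (Gn n) 2 μ := fun n => by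
    refine eHomSobolevSeminorm_half_eq_eLpNorm (Φ n) ?_
    rw [hΦ]
    exact hHae n
  -- `L³` control from the Sobolev inequality
  have h3n : ∀ n, MemLp (Φ n : EuclideanSpace ℝ (Fin 3) → F) 3 volume := fun n => by
    refine ⟨(Lp.memLp (Φ n)).1, lt_of_le_of_lt (hC _ (Lp.memLp (Φ n))) ?_⟩
    rw [hsemi1]
    exact ENNReal.mul_lt_top ENNReal.coe_lt_top (ha n).eLpNorm_lt_top
  -- `gₙ → g` in `L²(‖ξ‖ dξ)`
  have hconvG : Tendsto (fun n => eLpNorm (Gn n - G) 2 μ) atTop (𝓝 0) := by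
    have hlin : Tendsto (fun n => ∫⁻ ξ, ‖(Gn n - G) ξ‖ₑ ^ 2 ∂μ) atTop (𝓝 (∫⁻ _ξ, (0 : ℝ≥0∞) ∂μ)) := by
      refine tendsto_lintegral_of_dominated_convergence' (fun ξ => ‖G ξ‖ₑ ^ 2)
        (fun n => (((ha n).sub hG).1.enorm.pow_const _)) (fun n => Eventually.of_forall fun ξ => ?_)
        ?_ ?_
      · simp only [Pi.sub_apply, hGn_def]
        have : (A n).indicator G ξ - G ξ = -((A n)ᶜ.indicator G ξ) := by
          rw [eq_neg_iff_add_eq_zero, sub_add_eq_add_sub, sub_eq_zero]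
          exact congrFun (Set.indicator_self_add_compl (A n) G) ξ
        rw [this, enorm_neg]
        gcongr
        exact enorm_indicator_le_enorm_self _ _
      · have := lintegral_rpow_enorm_lt_top_of_eLpNorm_lt_top two_ne_zero ENNReal.ofNat_ne_top
          hG.eLpNorm_lt_top
        simp only [ENNReal.toReal_ofNat, ENNReal.rpow_ofNat] at this
        exact this.ne
      · filter_upwards [hac'.ae_le h0] with ξ hξ
        have hξ' : (ξ : EuclideanSpace ℝ (Fin 3)) ≠ 0 := hξ
        -- eventually `ξ ∉ ball 0 (n+1)⁻¹`, so the truncation error vanishes at `ξ`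
        have hev : ∀ᶠ n : ℕ in atTop, ‖(Gn n - G) ξ‖ₑ ^ 2 = 0 := by
          have hpos : 0 < ‖ξ‖ := norm_pos_iff.2 hξ'
          obtain ⟨N, hN⟩ := exists_nat_gt ‖ξ‖⁻¹
          refine eventually_atTop.2 ⟨N, fun n hn => ?_⟩
          have hmem : ξ ∈ A n := by
            simp only [hA_def, Set.mem_compl_iff, Metric.mem_ball, dist_zero_right, not_lt]
            rw [inv_le_comm₀ (by positivity) hpos]
            have : (N : ℝ) ≤ n := by exact_mod_cast hn
            linarith
          simp [hGn_def, Set.indicator_of_mem hmem]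
        exact tendsto_const_nhds.congr' (hev.mono fun n hn => hn.symm)
    rw [lintegral_zero] at hlin
    have h2 : ∀ n, eLpNorm (Gn n - G) 2 μ = (∫⁻ ξ, ‖(Gn n - G) ξ‖ₑ ^ 2 ∂μ) ^ (1 / 2 : ℝ) := fun n => by
      rw [eLpNorm_eq_lintegral_rpow_enorm_toReal two_ne_zero ENNReal.ofNat_ne_top]
      simp [ENNReal.rpow_ofNat]
    simp only [h2]
    have := ((ENNReal.continuous_rpow_const (y := (1 / 2 : ℝ))).tendsto (0 : ℝ≥0∞)).comp hlin
    rw [ENNReal.zero_rpow_of_pos (show (0 : ℝ) < 1 / 2 by norm_num)] at this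
    exact this
  -- the approximants are Cauchy in `L³`
  set T : ℕ → Lp F 3 (volume : Measure (EuclideanSpace ℝ (Fin 3))) := fun n => (h3n n).toLp _
    with hT_def
  have hTae : ∀ n, (T n : EuclideanSpace ℝ (Fin 3) → F) =ᵐ[volume] (Φ n : EuclideanSpace ℝ (Fin 3) → F) :=
    fun n => (h3n n).coeFn_toLp
  have hdistT : ∀ n m, edist (T n) (T m) ≤ C * eLpNorm (Gn n - Gn m) 2 μ := fun n m => by
    rw [Lp.edist_def, eLpNorm_congr_ae ((hTae n).sub (hTae m)), ← hsemi n m]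
    exact hC _ ((Lp.memLp _).sub (Lp.memLp _))
  set gL : ℕ → Lp F 2 μ := fun n => (ha n).toLp (Gn n) with hgL_def
  have hdistg : ∀ n m, edist (gL n) (gL m) = eLpNorm (Gn n - Gn m) 2 μ := fun n m => by
    rw [Lp.edist_def]
    exact eLpNorm_congr_ae (((ha n).coeFn_toLp).sub ((ha m).coeFn_toLp))
  have hcauchyG : CauchySeq gL := by
    refine Filter.Tendsto.cauchySeq (x := (toLp (1 / 2 : ℝ) g : Lp F 2 μ)) ?_
    rw [tendsto_iff_edist_tendsto_0]
    refine (tendsto_congr fun n => ?_).2 hconvG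
    rw [Lp.edist_def]
    exact eLpNorm_congr_ae (((ha n).coeFn_toLp).sub EventuallyEq.rfl)
  have hcauchyT : CauchySeq T := by
    rw [Metric.cauchySeq_iff] at hcauchyG ⊢
    intro ε hε
    obtain ⟨N, hN⟩ := hcauchyG (ε / ((C : ℝ) + 1)) (by positivity)
    refine ⟨N, fun m hm n hn => ?_⟩
    have h1 : dist (T m) (T n) ≤ (C : ℝ) * dist (gL m) (gL n) := by
      rw [dist_edist, dist_edist, ← ENNReal.coe_toReal, ← ENNReal.toReal_mul]
      refine ENNReal.toReal_mono (ENNReal.mul_ne_top ENNReal.coe_ne_top (edist_ne_top _ _)) ?_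
      rw [hdistg]
      exact hdistT m n
    have h2 : (C : ℝ) * (ε / ((C : ℝ) + 1)) < ε := by
      rw [mul_div_assoc', div_lt_iff₀ (by positivity)]
      nlinarith [C.coe_nonneg]
    calc dist (T m) (T n) ≤ (C : ℝ) * dist (gL m) (gL n) := h1
      _ ≤ (C : ℝ) * (ε / ((C : ℝ) + 1)) := by
          gcongr
          exact (hN m hm n hn).le
      _ < ε := h2
  obtain ⟨Tlim, hTlim⟩ := cauchySeq_tendsto_of_complete hcauchyT
  -- the limit `f ∈ L³` represents `g`
  refine ⟨(Tlim : EuclideanSpace ℝ (Fin 3) → F), Lp.memLp Tlim, ⟨fun φ => ?_, fun φ => ?_, fun φ => ?_⟩, ?_⟩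
  · haveI := hHT
    have hm : MemLp ((⇑(𝓕 φ : 𝓢(EuclideanSpace ℝ (Fin 3), ℂ))) • (Tlim : EuclideanSpace ℝ (Fin 3) → F))
        1 (volume : Measure (EuclideanSpace ℝ (Fin 3))) :=
      (Lp.memLp Tlim).smul ((𝓕 φ : 𝓢(EuclideanSpace ℝ (Fin 3), ℂ)).memLp (3 / 2) _)
    exact memLp_one_iff_integrable.1 hm
  · exact integrable_smul_of_memLp_half φ hG
  · haveI := hHT
    set ψ : 𝓢(EuclideanSpace ℝ (Fin 3), ℂ) := 𝓕 φ with hψ_def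
    -- the pairings of the approximants: `∫ 𝓕φ • fₙ = ∫ φ • gₙ`
    have hpair : ∀ n, ∫ x, ψ x • (Φ n : EuclideanSpace ℝ (Fin 3) → F) x = ∫ ξ, φ ξ • Gn n ξ :=
      fun n => by
      rw [hψ_def, integral_fourier_smul_eq_integral_smul_fourier_Lp φ (Φ n), hΦ n]
      exact integral_congr_ae ((hHae n).mono fun ξ hξ => by simp only [hξ])
    -- left-hand sides converge to `∫ 𝓕φ • f` (`fₙ → f` in `L³`, `𝓕φ ∈ L^{3/2}`)
    have hintn : ∀ n, Integrable (fun x => ψ x • (Φ n : EuclideanSpace ℝ (Fin 3) → F) x) volume :=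
      fun n => memLp_one_iff_integrable.1 ((h3n n).smul (ψ.memLp (3 / 2) _))
    have hintlim : Integrable (fun x => ψ x • (Tlim : EuclideanSpace ℝ (Fin 3) → F) x) volume :=
      memLp_one_iff_integrable.1 ((Lp.memLp Tlim).smul (ψ.memLp (3 / 2) _))
    have hL : Tendsto (fun n => ∫ x, ψ x • (Φ n : EuclideanSpace ℝ (Fin 3) → F) x) atTop
        (𝓝 (∫ x, ψ x • (Tlim : EuclideanSpace ℝ (Fin 3) → F) x)) := by
      rw [tendsto_iff_edist_tendsto_0]
      have hT0 : Tendsto (fun n => edist (T n) Tlim) atTop (𝓝 0) :=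
        tendsto_iff_edist_tendsto_0.1 hTlim
      have hup : Tendsto (fun n => eLpNorm ψ (3 / 2) volume * edist (T n) Tlim) atTop (𝓝 0) := by
        have := ENNReal.Tendsto.const_mul hT0 (Or.inr (ψ.memLp (3 / 2)
          (volume : Measure (EuclideanSpace ℝ (Fin 3)))).eLpNorm_ne_top)
        rwa [mul_zero] at this
      refine tendsto_of_tendsto_of_tendsto_of_le_of_le tendsto_const_nhds hup
        (fun n => zero_le) fun n => ?_
      rw [edist_eq_enorm_sub, ← integral_sub (hintn n) hintlim]
      refine (enorm_integral_le_lintegral_enorm _).trans ?_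
      rw [← eLpNorm_one_eq_lintegral_enorm]
      have hsm : (fun x => ψ x • (Φ n : EuclideanSpace ℝ (Fin 3) → F) x -
          ψ x • (Tlim : EuclideanSpace ℝ (Fin 3) → F) x) =
          (⇑ψ) • ((Φ n : EuclideanSpace ℝ (Fin 3) → F) - (Tlim : EuclideanSpace ℝ (Fin 3) → F)) := by
        funext x
        simp [smul_sub]
      rw [hsm]
      refine (eLpNorm_smul_le_mul_eLpNorm (p := 3 / 2) (q := 3) (r := 1)
        ((Lp.memLp (Φ n)).1.sub (Lp.memLp Tlim).1)
        ψ.continuous.aestronglyMeasurable).trans (le_of_eq ?_)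
      rw [Lp.edist_def, eLpNorm_congr_ae ((hTae n).sub EventuallyEq.rfl)]
    -- right-hand sides converge to `∫ φ • g` (`gₙ → g` in `L²(‖ξ‖ dξ)`)
    have hR : Tendsto (fun n => ∫ ξ, φ ξ • Gn n ξ) atTop (𝓝 (∫ ξ, φ ξ • G ξ)) := by
      rw [tendsto_iff_edist_tendsto_0]
      have hKtop : (∫⁻ ξ, ‖φ ξ‖ₑ ^ 2 * ‖ξ‖ₑ⁻¹) ^ (1 / 2 : ℝ) ≠ ∞ :=
        ENNReal.rpow_ne_top_of_nonneg (by norm_num) (lintegral_enorm_sq_mul_inv_enorm_lt_top φ).ne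
      have hup : Tendsto (fun n => (∫⁻ ξ, ‖φ ξ‖ₑ ^ 2 * ‖ξ‖ₑ⁻¹) ^ (1 / 2 : ℝ) *
          eLpNorm (Gn n - G) 2 μ) atTop (𝓝 0) := by
        have := ENNReal.Tendsto.const_mul hconvG (Or.inr hKtop)
        rwa [mul_zero] at this
      refine tendsto_of_tendsto_of_tendsto_of_le_of_le tendsto_const_nhds hup
        (fun n => zero_le) fun n => ?_
      rw [edist_eq_enorm_sub, ← integral_sub (integrable_smul_of_memLp_half φ (ha n))
        (integrable_smul_of_memLp_half φ hG)]
      simp only [← smul_sub]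
      exact enorm_integral_smul_le φ ((ha n).sub hG).1
    simp only [hpair] at hL
    exact tendsto_nhds_unique hL hR
  · -- the bound `‖f‖_{L³} ≤ C ‖g‖`: `‖fₙ‖_{L³} ≤ C ‖gₙ‖ ≤ C ‖g‖` and `fₙ → f` in `L³`
    have hGn_le : ∀ n, eLpNorm (Gn n) 2 μ ≤ eLpNorm G 2 μ := fun n => eLpNorm_indicator_le _
    have hG_eq : eLpNorm G 2 μ = ‖g‖ₑ := by
      rw [hG_def, ← Lp.enorm_def]
      rfl
    have hTn : ∀ n, ‖T n‖ₑ ≤ C * ‖g‖ₑ := fun n => by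
      rw [Lp.enorm_def, eLpNorm_congr_ae (hTae n)]
      calc eLpNorm (Φ n : EuclideanSpace ℝ (Fin 3) → F) 3 volume
          ≤ C * Function.eHomSobolevSeminorm (1 / 2 : ℝ) (Φ n : EuclideanSpace ℝ (Fin 3) → F) :=
            hC _ (Lp.memLp (Φ n))
        _ = C * eLpNorm (Gn n) 2 μ := by rw [hsemi1]
        _ ≤ C * ‖g‖ₑ := by
            rw [← hG_eq]
            gcongr
            exact hGn_le n
    have hlimT : Tendsto (fun n => ‖T n‖ₑ) atTop (𝓝 ‖Tlim‖ₑ) :=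
      (continuous_enorm.tendsto _).comp hTlim
    rw [← Lp.enorm_def]
    exact le_of_tendsto' hlimT hTn


/-- **The `L³` norm of a represented field is controlled by the `Ḣ^{1/2}` norm of its class**:
if `g ∈ Ḣ^{1/2}(ℝ³)` represents `f`, then `‖f‖_{L³} ≤ C ‖g‖` for every constant `C` of the
Sobolev inequality on `L²` (Bahouri–Chemin–Danchin 2011, Thm. 1.38, extended from `L² ∩ Ḣ^{1/2}`
to all of `Ḣ^{1/2}` by density: `f` is a.e. the `L³` limit of `exists_represents_eLpNorm_three_le`,
by `Represents.ae_eq`). This is the inequality behind "`u₀^k` bounded in `Ḣ^{1/2}`, hence in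
`L³`" when Rusin–Šverák's Cor. 4.2 / Cor. 4.3 (2011) are run in the `L³` setting of
Jia–Šverák 2013 (proof of Thm. 1) and Lemarié-Rieusset 2016 (Thm. 15.11).
[cite: BahouriCheminDanchin2011, Thm. 1.38 (d = 3, s = 1/2) with Prop. 1.34] -/
theorem _root_.Literature.Analysis.FunctionSpaces.HomSobolev.Represents.eLpNorm_three_le {C : ℝ≥0}
    (hC : ∀ f : EuclideanSpace ℝ (Fin 3) → F, MemLp f 2 volume →
      eLpNorm f 3 volume ≤ C * Function.eHomSobolevSeminorm (1 / 2 : ℝ) f)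
    {g : HomSobolev (EuclideanSpace ℝ (Fin 3)) F (1 / 2 : ℝ)} {f : EuclideanSpace ℝ (Fin 3) → F}
    (h : g.Represents f) : eLpNorm f 3 volume ≤ C * ‖g‖ₑ := by
  obtain ⟨f', -, hrep, hle⟩ := exists_represents_eLpNorm_three_le hC g
  rw [eLpNorm_congr_ae (h.ae_eq hrep)]
  exact hle

/-- **`‖f‖_{L³(ℝ³)} ≤ C ‖g‖_{Ḣ^{1/2}(ℝ³)}` whenever `g` represents `f`**, unconditionally, with
the constant of the discharged Sobolev inequality
`eLpNorm_three_le_eHomSobolevSeminorm_half_holds` (Bahouri–Chemin–Danchin 2011, Thm. 1.38).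
[cite: BahouriCheminDanchin2011, Thm. 1.38 (d = 3, s = 1/2)] -/
theorem _root_.Literature.Analysis.FunctionSpaces.HomSobolev.exists_const_eLpNorm_three_le_of_represents :
    ∃ C : ℝ≥0, ∀ (g : HomSobolev (EuclideanSpace ℝ (Fin 3)) F (1 / 2 : ℝ)) (f : EuclideanSpace ℝ (Fin 3) → F),
      g.Represents f → eLpNorm f 3 volume ≤ C * ‖g‖ₑ := by
  obtain ⟨C, hC⟩ := @FunctionSpaces.eLpNorm_three_le_eHomSobolevSeminorm_half_holds F _ _ _
  exact ⟨C, fun g f h => h.eLpNorm_three_le hC⟩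

/-- **Every field represented by a class in `Ḣ^{1/2}(ℝ³)` is an `L³` field** (the Sobolev
embedding `Ḣ^{1/2}(ℝ³) ⊂ L³(ℝ³)`, Bahouri–Chemin–Danchin 2011, Thm. 1.38, for represented
fields: `f` is a.e. equal to the `L³` representative of `exists_represents_eLpNorm_three_le`).
In particular the hypothesis `MemLp u₀ 3` accompanying `g.Represents (complexify ∘ u₀)` in the
tree's Navier–Stokes facts is automatic. [cite: BahouriCheminDanchin2011, Thm. 1.38 (d = 3, s = 1/2)] -/
theorem _root_.Literature.Analysis.FunctionSpaces.HomSobolev.Represents.memLp_three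
    {g : HomSobolev (EuclideanSpace ℝ (Fin 3)) F (1 / 2 : ℝ)} {f : EuclideanSpace ℝ (Fin 3) → F}
    (h : g.Represents f) : MemLp f 3 volume := by
  obtain ⟨C, hC⟩ := @FunctionSpaces.eLpNorm_three_le_eHomSobolevSeminorm_half_holds F _ _ _
  obtain ⟨f', hf', hrep, -⟩ := exists_represents_eLpNorm_three_le hC g
  exact hf'.ae_eq (hrep.ae_eq h)

end SobolevRepr

/-! ## Weak `Ḣ^{1/2}` convergence of classes gives weak `L³` convergence of the fields -/

section WeakL3

universe u

variable {F : Type u} [NormedAddCommGroup F] [InnerProductSpace ℂ F] [CompleteSpace F]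

omit [CompleteSpace F] in
/-- **Hölder pairing `L^{3/2} × L³`**: for `h ∈ L^{3/2}(ℝ³; ℂ)` and `f ∈ L³(ℝ³; F)` the pairing
`x ↦ h(x) • f(x)` is integrable and `‖∫ h • f‖ ≤ ‖h‖_{L^{3/2}} ‖f‖_{L³}` (Mathlib
`eLpNorm_smul_le_mul_eLpNorm` with the Hölder triple `(3/2, 3, 1)`). [folklore] -/
theorem _root_.Literature.Analysis.FunctionSpaces.HomSobolev.norm_integral_smul_le_of_memLp
    {f : EuclideanSpace ℝ (Fin 3) → F} {h : EuclideanSpace ℝ (Fin 3) → ℂ}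
    (hf : MemLp f 3 volume) (hh : MemLp h (3 / 2 : ℝ≥0∞) volume) :
    Integrable (fun x => h x • f x) volume ∧
      ‖∫ x, h x • f x‖ ≤ (eLpNorm h (3 / 2 : ℝ≥0∞) volume).toReal * (eLpNorm f 3 volume).toReal := by
  haveI hHT : ENNReal.HolderTriple (3 / 2) 3 1 := by
    refine ⟨?_⟩
    have h1 : (3 / 2 : ℝ≥0∞)⁻¹ = 2 * 3⁻¹ := by
      rw [div_eq_mul_inv, ENNReal.mul_inv (Or.inl (by norm_num)) (Or.inl (by norm_num)), inv_inv,
        mul_comm]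
    rw [h1, inv_one]
    calc (2 : ℝ≥0∞) * 3⁻¹ + 3⁻¹ = (2 + 1) * 3⁻¹ := by rw [add_mul, one_mul]
      _ = 3 * 3⁻¹ := by norm_num
      _ = 1 := ENNReal.mul_inv_cancel (by norm_num) (by norm_num)
  have hm : MemLp (h • f) 1 volume := hf.smul hh
  have hint : Integrable (fun x => h x • f x) volume := memLp_one_iff_integrable.1 hm
  refine ⟨hint, ?_⟩
  have h1 : eLpNorm (h • f) 1 volume ≤ eLpNorm h (3 / 2) volume * eLpNorm f 3 volume :=
    eLpNorm_smul_le_mul_eLpNorm hf.1 hh.1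
  calc ‖∫ x, h x • f x‖ ≤ ∫ x, ‖h x • f x‖ := norm_integral_le_integral_norm _
    _ = (∫⁻ x, ‖h x • f x‖ₑ).toReal := integral_norm_eq_lintegral_enorm hint.1
    _ = (eLpNorm (h • f) 1 volume).toReal := by rw [eLpNorm_one_eq_lintegral_enorm]; rfl
    _ ≤ (eLpNorm h (3 / 2) volume * eLpNorm f 3 volume).toReal :=
        ENNReal.toReal_mono (ENNReal.mul_ne_top hh.eLpNorm_ne_top hf.eLpNorm_ne_top) h1
    _ = _ := ENNReal.toReal_mul

/-- **Weak `Ḣ^{1/2}` limits of represented data are weak `L³` limits.** Let `gₙ ⇀ g` weakly in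
`Ḣ^{1/2}(ℝ³; F)` (`⟪gₙ, w⟫ → ⟪g, w⟫` for all `w`) with `‖gₙ‖ ≤ R`, and let `gₙ` represent `fₙ`
and `g` represent `f`. Then `⟪c, ∫ ψ • fₙ⟫ → ⟪c, ∫ ψ • f⟫` for every `ψ ∈ L^{3/2}(ℝ³; ℂ)` and
every `c ∈ F`, i.e. `fₙ ⇀ f` weakly in `L³` (tested against `ψ ⊗ c`). Proof: the `fₙ` and `f`
are bounded in `L³` by `C · max(R, 0)` (`Represents.eLpNorm_three_le`; `‖g‖ ≤ max(R,0)` by weak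
lower semicontinuity, `norm_le_of_tendsto_inner_of_norm_le`); approximate `ψ` in `L^{3/2}` by a
test function `φ` (Mathlib `MemLp.exist_eLpNorm_sub_le`), for which the convergence is
`Represents.tendsto_inner_integral_smul` (`HomSobolevWeakLimits.lean`), and bound the two error
terms by Hölder (`norm_integral_smul_le_of_memLp`). This is the sentence "`u₀^k ⇀ u₀` in
`L³(ℝ³)`" of Jia–Šverák 2013, proof of Thm. 1 (arXiv:1201.1592 §5) — "`ŵ_{n_k} ⇀* w_∞`" in
Lemarié-Rieusset 2016, Thm. 15.11 — for data given, as in Rusin–Šverák 2011 (proof of Cor. 4.3,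
p. 8: "the functions `v₀^k` converge weakly in `Ḣ^{1/2}` to `v₀`"), by weakly convergent
`Ḣ^{1/2}` classes. [cite: JiaSverak2013, proof of Thm. 1 (arXiv:1201.1592 §5: u₀^k ⇀ u₀ in L³)] -/
theorem _root_.Literature.Analysis.FunctionSpaces.HomSobolev.Represents.tendsto_inner_integral_smul_of_memLp
    {gseq : ℕ → HomSobolev (EuclideanSpace ℝ (Fin 3)) F (1 / 2 : ℝ)}
    {glim : HomSobolev (EuclideanSpace ℝ (Fin 3)) F (1 / 2 : ℝ)}
    (hw : ∀ w : HomSobolev (EuclideanSpace ℝ (Fin 3)) F (1 / 2 : ℝ),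
      Tendsto (fun n => ⟪gseq n, w⟫_ℂ) atTop (𝓝 ⟪glim, w⟫_ℂ))
    (hR : ∃ R : ℝ, ∀ n, ‖gseq n‖ ≤ R)
    {fseq : ℕ → EuclideanSpace ℝ (Fin 3) → F} {flim : EuclideanSpace ℝ (Fin 3) → F}
    (hseq : ∀ n, (gseq n).Represents (fseq n)) (hlim : glim.Represents flim)
    {ψ : EuclideanSpace ℝ (Fin 3) → ℂ} (hψ : MemLp ψ (3 / 2 : ℝ≥0∞) volume) (c : F) :
    Tendsto (fun n => ⟪c, ∫ x, ψ x • fseq n x⟫_ℂ) atTop (𝓝 ⟪c, ∫ x, ψ x • flim x⟫_ℂ) := by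
  obtain ⟨C, hC⟩ := exists_const_eLpNorm_three_le_of_represents (F := F)
  obtain ⟨R, hR⟩ := hR
  -- uniform `L³` bounds of the fields
  set M : ℝ := C * max R 0 with hM
  have hM0 : 0 ≤ M := by positivity
  have hbound : ∀ {g : HomSobolev (EuclideanSpace ℝ (Fin 3)) F (1 / 2 : ℝ)}
      {f : EuclideanSpace ℝ (Fin 3) → F}, g.Represents f → ‖g‖ ≤ max R 0 →
      (eLpNorm f 3 volume).toReal ≤ M := by
    intro g f hg hgn
    have h1 := hC g f hg
    have h2 : (C : ℝ≥0∞) * ‖g‖ₑ ≠ ∞ := ENNReal.mul_ne_top ENNReal.coe_ne_top enorm_ne_top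
    have h3 := ENNReal.toReal_mono h2 h1
    rw [ENNReal.toReal_mul, ENNReal.coe_toReal, toReal_enorm] at h3
    refine h3.trans ?_
    rw [hM]
    gcongr
  have hfn : ∀ n, (eLpNorm (fseq n) 3 volume).toReal ≤ M := fun n =>
    hbound (hseq n) ((hR n).trans (le_max_left _ _))
  have hglim : ‖glim‖ ≤ max R 0 :=
    norm_le_of_tendsto_inner_of_norm_le hw tendsto_const_nhds fun n => (hR n).trans (le_max_left _ _)
  have hfl : (eLpNorm flim 3 volume).toReal ≤ M := hbound hlim hglim
  have hf3 : ∀ n, MemLp (fseq n) 3 volume := fun n => (hseq n).memLp_three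
  have hfl3 : MemLp flim 3 volume := hlim.memLp_three
  rw [Metric.tendsto_atTop]
  intro ε hε
  -- approximate `ψ` in `L^{3/2}` by a test function `φ`
  set K : ℝ := ‖c‖ * M + 1 with hK
  have hK0 : 0 < K := by positivity
  have h32top : (3 / 2 : ℝ≥0∞) ≠ ⊤ := (ENNReal.div_lt_top (by norm_num) (by norm_num)).ne
  have h32one : (1 : ℝ≥0∞) ≤ 3 / 2 := by
    rw [ENNReal.le_div_iff_mul_le (Or.inl (by norm_num)) (Or.inl (by norm_num))]
    norm_num
  obtain ⟨θ, hθc, hθs, hθle⟩ := hψ.exist_eLpNorm_sub_le h32top h32one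
    (show 0 < ε / (4 * K) by positivity)
  set φ : 𝓢(EuclideanSpace ℝ (Fin 3), ℂ) := hθc.toSchwartzMap hθs with hφ_def
  have hφθ : ∀ x, φ x = θ x := fun x => rfl
  have hdiff : MemLp (fun x => ψ x - φ x) (3 / 2 : ℝ≥0∞) volume :=
    hψ.sub (φ.memLp (3 / 2 : ℝ≥0∞) volume)
  have hdiff_le : (eLpNorm (fun x => ψ x - φ x) (3 / 2 : ℝ≥0∞) volume).toReal ≤ ε / (4 * K) := by
    have h1 := ENNReal.toReal_mono ENNReal.ofReal_ne_top hθle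
    rw [ENNReal.toReal_ofReal (by positivity)] at h1
    exact h1
  -- the pairings with the test function converge
  have hmid := Represents.tendsto_inner_integral_smul hw hseq hlim φ c
  rw [Metric.tendsto_atTop] at hmid
  obtain ⟨N, hN⟩ := hmid (ε / 2) (by positivity)
  refine ⟨N, fun n hn => ?_⟩
  -- the error terms are uniformly small
  have herr : ∀ {f : EuclideanSpace ℝ (Fin 3) → F}, MemLp f 3 volume →
      (eLpNorm f 3 volume).toReal ≤ M →
      dist ⟪c, ∫ x, ψ x • f x⟫_ℂ ⟪c, ∫ x, φ x • f x⟫_ℂ ≤ ε / 4 := by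
    intro f hf hfM
    obtain ⟨hint1, -⟩ := norm_integral_smul_le_of_memLp hf hψ
    obtain ⟨hint2, -⟩ := norm_integral_smul_le_of_memLp hf (φ.memLp (3 / 2 : ℝ≥0∞) volume)
    obtain ⟨-, hle⟩ := norm_integral_smul_le_of_memLp hf hdiff
    rw [dist_eq_norm, ← inner_sub_right, ← integral_sub hint1 hint2]
    calc ‖⟪c, ∫ x, (ψ x • f x - φ x • f x)⟫_ℂ‖ ≤ ‖c‖ * ‖∫ x, (ψ x • f x - φ x • f x)‖ :=
          norm_inner_le_norm _ _
      _ = ‖c‖ * ‖∫ x, (ψ x - φ x) • f x‖ := by simp only [sub_smul]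
      _ ≤ ‖c‖ * ((eLpNorm (fun x => ψ x - φ x) (3 / 2 : ℝ≥0∞) volume).toReal *
            (eLpNorm f 3 volume).toReal) := by gcongr
      _ ≤ ‖c‖ * (ε / (4 * K) * M) := by gcongr
      _ ≤ ε / 4 := by
          have h1 : ‖c‖ * M ≤ K := by rw [hK]; linarith
          calc ‖c‖ * (ε / (4 * K) * M) = ε / (4 * K) * (‖c‖ * M) := by ring
            _ ≤ ε / (4 * K) * K := by gcongr
            _ = ε / 4 := by field_simp
  have h1 := herr (hf3 n) (hfn n)
  have h2 := hN n hn
  have h3 := herr hfl3 hfl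
  rw [dist_comm] at h3
  calc dist ⟪c, ∫ x, ψ x • fseq n x⟫_ℂ ⟪c, ∫ x, ψ x • flim x⟫_ℂ
      ≤ dist ⟪c, ∫ x, ψ x • fseq n x⟫_ℂ ⟪c, ∫ x, φ x • fseq n x⟫_ℂ +
          dist ⟪c, ∫ x, φ x • fseq n x⟫_ℂ ⟪c, ∫ x, φ x • flim x⟫_ℂ +
          dist ⟪c, ∫ x, φ x • flim x⟫_ℂ ⟪c, ∫ x, ψ x • flim x⟫_ℂ := dist_triangle4 _ _ _ _
    _ < ε / 4 + ε / 2 + ε / 4 := add_lt_add_of_lt_of_le (add_lt_add_of_le_of_lt h1 h2) h3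
    _ = ε := by ring

end WeakL3

/-! ## Real data of the Navier–Stokes facts: `‖u₀‖_{L³} ≤ C ‖g‖_{Ḣ^{1/2}}` -/

section NS

/-- `‖complexify ∘ u₀‖_{L^p} = ‖u₀‖_{L^p}`: complexification is an isometry pointwise
(`norm_complexify`). [folklore] -/
theorem eLpNorm_complexify_comp (u₀ : (EuclideanSpace ℝ (Fin 3)) → EuclideanSpace ℝ (Fin 3)) (p : ℝ≥0∞) :
    eLpNorm (FunctionSpaces.EuclideanSpace.complexify ∘ u₀) p volume = eLpNorm u₀ p volume :=
  eLpNorm_congr_norm_ae (Eventually.of_forall fun x => FunctionSpaces.EuclideanSpace.norm_complexify (u₀ x))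

/-- **A real field represented in `Ḣ^{1/2}(ℝ³; ℂ³)` is an `L³` field**: if `g` represents
`complexify ∘ u₀`, then `u₀ ∈ L³(ℝ³; ℝ³)` (`Represents.memLp_three` and
`memLp_complexify_comp_iff`). The `MemLp u₀ 3` clauses of `rusin_sverak_weak_limit_blowup`,
`rusin_sverak_singular_point_of_blowup`, `rusin_sverak_weak_limit_of_singular_points`,
`rusinSverakRhoMaxPure` are thus consequences of the representation clauses.
[cite: BahouriCheminDanchin2011, Thm. 1.38 (d = 3, s = 1/2)] -/
theorem memLp_three_of_represents_complexify {g : FunctionSpaces.HomSobolev (EuclideanSpace ℝ (Fin 3)) (EuclideanSpace ℂ (Fin 3)) (1 / 2 : ℝ)} {u₀ : (EuclideanSpace ℝ (Fin 3)) → EuclideanSpace ℝ (Fin 3)}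
    (h : g.Represents (FunctionSpaces.EuclideanSpace.complexify ∘ u₀)) : MemLp u₀ 3 volume :=
  memLp_complexify_comp_iff.1 h.memLp_three

/-- **`‖u₀‖_{L³} ≤ C ‖g‖_{Ḣ^{1/2}}` for real data**: there is `C` such that every real field
`u₀ : ℝ³ → ℝ³` whose complexification is represented by `g ∈ Ḣ^{1/2}(ℝ³; ℂ³)` satisfies
`‖u₀‖_{L³} ≤ C ‖g‖` (Bahouri–Chemin–Danchin 2011, Thm. 1.38, through
`exists_const_eLpNorm_three_le_of_represents` and `‖complexify v‖ = ‖v‖`).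
[cite: BahouriCheminDanchin2011, Thm. 1.38 (d = 3, s = 1/2)] -/
theorem exists_const_eLpNorm_three_le_of_represents_complexify :
    ∃ C : ℝ≥0, ∀ (u₀ : (EuclideanSpace ℝ (Fin 3)) → EuclideanSpace ℝ (Fin 3)) (g : FunctionSpaces.HomSobolev (EuclideanSpace ℝ (Fin 3)) (EuclideanSpace ℂ (Fin 3)) (1 / 2 : ℝ)),
      g.Represents (FunctionSpaces.EuclideanSpace.complexify ∘ u₀) → eLpNorm u₀ 3 volume ≤ C * ‖g‖ₑ := by
  obtain ⟨C, hC⟩ := FunctionSpaces.HomSobolev.exists_const_eLpNorm_three_le_of_represents (F := EuclideanSpace ℂ (Fin 3))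
  refine ⟨C, fun u₀ g h => ?_⟩
  rw [← eLpNorm_complexify_comp]
  exact hC g _ h

/-- **Data bounded in `Ḣ^{1/2}` are bounded in `L³`**: if the classes `g_k ∈ Ḣ^{1/2}(ℝ³; ℂ³)`
representing the real fields `u₀^k` satisfy `‖g_k‖ ≤ R`, then `‖u₀^k‖_{L³} ≤ M` for some `M`
(namely `C · max(R, 0)`). This turns the hypothesis "`∃ R, ∀ k, ‖g k‖ ≤ R`" of
`rusin_sverak_weak_limit_of_singular_points` / `rusin_sverak_weak_limit_blowup` (Rusin–Šverák
2011, Thm. 4.2 / Cor. 4.2: "a bounded sequence of initial conditions in `Ḣ^{1/2}`") into the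
`L³` bound `sup_k ‖u₀^k‖_{L³} < ∞` under which Jia–Šverák 2013 (proof of Thm. 1, arXiv §5) and
Lemarié-Rieusset 2016 (Thm. 15.11, the set `ℬ_{3,M}`) carry out the same argument.
[cite: BahouriCheminDanchin2011, Thm. 1.38 (d = 3, s = 1/2)] -/
theorem exists_eLpNorm_three_le_of_represents_of_norm_le {ι : Type*} {u₀ : ι → (EuclideanSpace ℝ (Fin 3)) → EuclideanSpace ℝ (Fin 3)}
    {g : ι → FunctionSpaces.HomSobolev (EuclideanSpace ℝ (Fin 3)) (EuclideanSpace ℂ (Fin 3)) (1 / 2 : ℝ)}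
    (hrep : ∀ k, (g k).Represents (FunctionSpaces.EuclideanSpace.complexify ∘ u₀ k))
    (hR : ∃ R : ℝ, ∀ k, ‖g k‖ ≤ R) :
    ∃ M : ℝ≥0, ∀ k, eLpNorm (u₀ k) 3 volume ≤ M := by
  obtain ⟨C, hC⟩ := exists_const_eLpNorm_three_le_of_represents_complexify
  obtain ⟨R, hR⟩ := hR
  refine ⟨C * R.toNNReal, fun k => (hC (u₀ k) (g k) (hrep k)).trans ?_⟩
  rw [ENNReal.coe_mul]
  gcongr
  rw [← ofReal_norm, ← ENNReal.ofReal_coe_nnreal, Real.coe_toNNReal']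
  exact ENNReal.ofReal_le_ofReal ((hR k).trans (le_max_left _ _))

end NS

end HomSobolev

end Literature.Analysis.FluidPDE
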